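import Mathlib.Analysis.InnerProductSpace.PiL2
import Mathlib.Analysis.InnerProductSpace.Projection.FiniteDimensional
import Mathlib.Topology.MetricSpace.Basic
import Literature.Geometry.DiscreteGeometry.KissingPatterns
import Literature.MathematicalPhysics.StatisticalMechanics.BarlowStacking
import Summits.AtomisticToContinuum.Crystallization.Theorems.HullExactificationCascadeRobustBarlowTemplateDefs
import Summits.AtomisticToContinuum.Crystallization.Theorems.PalmUnimodularRigidityShellsToBarlowChartLocalCharts
import HarnessLib

/-!
# Stub `develop_charts` for line `registered`
(crux `RobustBarlowTemplate`, stmt-AtomisticToContinuum-12088; first piece of the reshaped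
`stub_develop`)

## Statement
`develop_charts`: for a separated configuration `S ⊆ ℝ³` all of whose points are `1/20`-good
(`Good S y`: the recentred shell, rescaled by the nearest-neighbour distance `nnd S y`, is
`1/20`-matched after a linear isometry to the FCC or the HCP kissing pattern) and whose shell
relation is reciprocal with comparable scales (`Recip S`), every point `x ∈ S` has a LOCAL CHART WITH
EXACT LINKS: a labelling `e : P → shell S x` (`P` the FCC or the HCP pattern), bijective, with
`dist (e v) (x + nnd S x • A v) ≤ nnd S x / 20`, and such that two shell points `e v`, `e w` are
shell-neighbours of each other iff `dist v w = 1`.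

## Proof outline
* `charts_matching_basic`: a matching at `y` forces `0 < nnd S y` (the shell is nonempty, and its
  points are at distance `< 13/10 · nnd S y`) and puts every shell point within `21/20 · nnd S y` of
  `y` (pattern points are unit vectors, tolerance `1/20`).
* `charts_of_matching` (uniform in the pattern `P`): the matching `e₀ : shell S x ≃ P` is inverted
  to the labelling `e`; bijectivity is formal; the estimate is the matching estimate multiplied by
  `d = nnd S x`; pair distances satisfy `|dist (e v) (e w) − d · dist v w| ≤ d/10`.  Links: if
  `dist v w = 1` then `dist (e w) (e v) ≤ 11/10 · d < 13/10 · 9/10 · d ≤ 13/10 · nnd S (e v)` by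
  reciprocity of scales; conversely if `e w ∈ shell S (e v)` then, by goodness AT `e v`,
  `dist (e w) (e v) ≤ 21/20 · nnd S (e v) ≤ 21/20 · 10/9 · d = 7/6 · d`, so
  `d · dist v w ≤ (7/6 + 1/10) d = 19/15 · d`, `dist v w ≤ 19/15 < √2`, and the pattern
  pair-distance dichotomy (`dist v w = 1 ∨ √2 ≤ dist v w`, from the sibling crux 9227) gives
  `dist v w = 1`.
* `develop_charts`: case on the pattern inside `Good S x`.

## Contents
* `charts_matching_basic`, `charts_good_basic` — positive scale and the `21/20` shell bound.
* `charts_of_matching` — the chart from one matched shell, uniform in the pattern.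
* `develop_charts` — the registered stub.
-/

noncomputable section

namespace Summit.AtomisticToContinuum.Crystallization.Theorems.HullExactificationCascadeRobustBarlowTemplate

open Literature.MathematicalPhysics.StatisticalMechanics Literature.Geometry.DiscreteGeometry
open RealInnerProductSpace
open Summit.AtomisticToContinuum.Crystallization.Theorems.PalmUnimodularRigidityShellsToBarlowChart
  (dist_eq_one_or_sqrt_two_le_of_mem_fccKissingPattern
    dist_eq_one_or_sqrt_two_le_of_mem_hcpKissingPattern)

/-- Euclidean `3`-space. -/
local notation "E3" => EuclideanSpace ℝ (Fin 3)

/-! ## Basic consequences of one matching -/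

/-- A shell of `y` matched (after rescaling by `nnd S y` and a linear isometry, tolerance `1/20`)
to a nonempty pattern of unit vectors has positive scale `nnd S y`, and all its points lie within
`21/20 · nnd S y` of `y`. [folklore] -/
theorem charts_matching_basic {S : Set E3} {y : E3} {P : Finset E3} (hP1 : ∀ v ∈ P, ‖v‖ = 1)
    (hPne : P.Nonempty) (A : E3 →ₗᵢ[ℝ] E3) (e₀ : ↥(shell S y) ≃ ↥P)
    (he₀ : ∀ t : ↥(shell S y),
      dist ((nnd S y)⁻¹ • ((t : E3) - y)) (A ((e₀ t : ↥P) : E3)) ≤ 1 / 20) :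
    0 < nnd S y ∧ ∀ t ∈ shell S y, dist t y ≤ 21 / 20 * nnd S y := by
  have hpos : 0 < nnd S y := by
    obtain ⟨v, hv⟩ := hPne
    have h := (e₀.symm ⟨v, hv⟩).2.2.2
    linarith [dist_nonneg (x := ((e₀.symm ⟨v, hv⟩ : ↥(shell S y)) : E3)) (y := y)]
  refine ⟨hpos, fun t ht => ?_⟩
  have h := he₀ ⟨t, ht⟩
  have hu : ‖A ((e₀ ⟨t, ht⟩ : ↥P) : E3)‖ = 1 := by
    rw [LinearIsometry.norm_map]
    exact hP1 _ (e₀ ⟨t, ht⟩).2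
  have h1 : ‖(nnd S y)⁻¹ • ((t : E3) - y)‖ ≤ 21 / 20 := by
    have h2 := norm_sub_norm_le ((nnd S y)⁻¹ • ((t : E3) - y)) (A ((e₀ ⟨t, ht⟩ : ↥P) : E3))
    rw [← dist_eq_norm, hu] at h2
    linarith
  rw [norm_smul, norm_inv, Real.norm_of_nonneg hpos.le, ← dist_eq_norm,
    inv_mul_le_iff₀ hpos] at h1
  linarith

/-- A `1/20`-good point has positive scale and its shell lies within `21/20` of its scale.
[folklore] -/
theorem charts_good_basic {S : Set E3} {y : E3} (h : Good S y) :
    0 < nnd S y ∧ ∀ t ∈ shell S y, dist t y ≤ 21 / 20 * nnd S y := by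
  obtain ⟨A, ⟨e₀, he₀⟩ | ⟨e₀, he₀⟩⟩ := h
  · exact charts_matching_basic (fun v hv => norm_eq_one_of_mem_fccKissingPattern hv)
      (Finset.card_pos.1 (by rw [card_fccKissingPattern]; norm_num)) A e₀ he₀
  · exact charts_matching_basic (fun v hv => norm_eq_one_of_mem_hcpKissingPattern hv)
      (Finset.card_pos.1 (by rw [card_hcpKissingPattern]; norm_num)) A e₀ he₀

/-! ## The chart from one matched shell -/

/-- **Local chart with exact links from one matched shell** (uniform in the pattern).  If the shell
of `x ∈ S` is `1/20`-matched at scale `d = nnd S x` to `A '' P` for a nonempty pattern `P` of unit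
vectors with the pair-distance dichotomy `dist v w = 1 ∨ √2 ≤ dist v w`, all points of `S` are good
and shells are reciprocal with comparable scales, then inverting the matching labels `shell S x`
bijectively by `P`, each label within `d/20` of `x + d • A v`, and `e w ∈ shell S (e v)` iff
`dist v w = 1`: pair distances are `d · dist v w ± d/10`, touching labels give
`dist ≤ 11/10 · d < 13/10 · 9/10 · d`, and a shell-neighbour pair has
`d · dist v w ≤ 21/20 · 10/9 · d + d/10 = 19/15 · d < √2 · d`. [folklore] -/
theorem charts_of_matching {S : Set E3} (hG : ∀ y ∈ S, Good S y) (hR : Recip S) {x : E3}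
    (hx : x ∈ S) {P : Finset E3} (hP1 : ∀ v ∈ P, ‖v‖ = 1) (hPne : P.Nonempty)
    (hP2 : ∀ v ∈ P, ∀ w ∈ P, v ≠ w → dist v w = 1 ∨ Real.sqrt 2 ≤ dist v w)
    (A : E3 →ₗᵢ[ℝ] E3) (e₀ : ↥(shell S x) ≃ ↥P)
    (he₀ : ∀ t : ↥(shell S x),
      dist ((nnd S x)⁻¹ • ((t : E3) - x)) (A ((e₀ t : ↥P) : E3)) ≤ 1 / 20) :
    ∃ e : E3 → E3, Set.BijOn e (↑P : Set E3) (shell S x) ∧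
      (∀ v ∈ P, dist (e v) (x + nnd S x • A v) ≤ nnd S x / 20) ∧
      (∀ v ∈ P, ∀ w ∈ P, (dist v w = 1 ↔ e w ∈ shell S (e v))) := by
  classical
  obtain ⟨hd, -⟩ := charts_matching_basic hP1 hPne A e₀ he₀
  -- the labelling: invert the matching (junk value `x` off `P`)
  obtain ⟨e, he⟩ : ∃ e : E3 → E3, ∀ v (hv : v ∈ P),
      e v = ((e₀.symm ⟨v, hv⟩ : ↥(shell S x)) : E3) :=
    ⟨fun v => if hv : v ∈ P then ((e₀.symm ⟨v, hv⟩ : ↥(shell S x)) : E3) else x,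
      fun v hv => dif_pos hv⟩
  -- (1) labels are shell points
  have hmem : ∀ v ∈ P, e v ∈ shell S x := by
    intro v hv
    rw [he v hv]
    exact (e₀.symm ⟨v, hv⟩).2
  -- (2) each label is `d/20`-close to the rotated scaled pattern point
  have hdist : ∀ v ∈ P, dist (e v) (x + nnd S x • A v) ≤ nnd S x / 20 := by
    intro v hv
    have h := he₀ (e₀.symm ⟨v, hv⟩)
    rw [Equiv.apply_symm_apply, ← he v hv] at h
    have key : e v - (x + nnd S x • A v) = nnd S x • ((nnd S x)⁻¹ • (e v - x) - A v) := by
      rw [smul_sub, smul_inv_smul₀ hd.ne', sub_add_eq_sub_sub]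
    rw [dist_eq_norm, key, norm_smul, Real.norm_of_nonneg hd.le, ← dist_eq_norm]
    calc nnd S x * dist ((nnd S x)⁻¹ • (e v - x)) (A v)
        ≤ nnd S x * (1 / 20) := mul_le_mul_of_nonneg_left h hd.le
      _ = nnd S x / 20 := by ring
  -- (3) pair distances are within `d/10` of the scaled pattern distances
  have hpair : ∀ v ∈ P, ∀ w ∈ P,
      |dist (e v) (e w) - nnd S x * dist v w| ≤ nnd S x / 10 := by
    intro v hv w hw
    have hA : dist (x + nnd S x • A v) (x + nnd S x • A w) = nnd S x * dist v w := by
      rw [dist_add_left, dist_smul₀, LinearIsometry.dist_map, Real.norm_of_nonneg hd.le]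
    have h1 := hdist v hv
    have h2 := hdist w hw
    rw [abs_sub_le_iff]
    constructor
    · linarith [dist_triangle4 (e v) (x + nnd S x • A v) (x + nnd S x • A w) (e w),
        dist_comm (e w) (x + nnd S x • A w)]
    · linarith [dist_triangle4 (x + nnd S x • A v) (e v) (e w) (x + nnd S x • A w),
        dist_comm (e v) (x + nnd S x • A v)]
  -- (4) the labelling is injective on `P`
  have hinj : Set.InjOn e (↑P : Set E3) := by
    intro v hv w hw hvw
    have hv' : v ∈ P := Finset.mem_coe.1 hv
    have hw' : w ∈ P := Finset.mem_coe.1 hw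
    rw [he v hv', he w hw'] at hvw
    exact congrArg Subtype.val (e₀.symm.injective (Subtype.ext hvw))
  refine ⟨e, ⟨fun v hv => hmem v (Finset.mem_coe.1 hv), hinj, ?_⟩, hdist, ?_⟩
  · -- onto the shell
    intro t ht
    refine ⟨((e₀ ⟨t, ht⟩ : ↥P) : E3), Finset.mem_coe.2 (e₀ ⟨t, ht⟩).2, ?_⟩
    rw [he _ (e₀ ⟨t, ht⟩).2, Subtype.coe_eta, Equiv.symm_apply_apply]
  · -- links are exact
    intro v hv w hw
    have ht := hmem v hv
    have ht' := hmem w hw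
    obtain ⟨-, h9, h10⟩ := hR x hx (e v) ht
    have hb := hpair v hv w hw
    rw [abs_le] at hb
    obtain ⟨hb1, hb2⟩ := hb
    constructor
    · intro h1
      have hvw : v ≠ w := by
        rintro rfl
        rw [dist_self] at h1
        exact zero_ne_one h1
      refine ⟨ht'.1, fun h => hvw (hinj (Finset.mem_coe.2 hv) (Finset.mem_coe.2 hw) h.symm), ?_⟩
      rw [h1, mul_one] at hb2
      rw [dist_comm]
      linarith
    · intro h2
      have hvw : v ≠ w := by
        rintro rfl
        exact h2.2.1 rfl
      rcases hP2 v hv w hw hvw with h | h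
      · exact h
      · exfalso
        have hle := (charts_good_basic (hG (e v) ht.1)).2 (e w) h2
        have hsq : (19 / 15 : ℝ) < Real.sqrt 2 := by
          rw [show (19 / 15 : ℝ) = Real.sqrt ((19 / 15) ^ 2) by rw [Real.sqrt_sq]; norm_num]
          exact Real.sqrt_lt_sqrt (by norm_num) (by norm_num)
        have h3 : nnd S x * (19 / 15) < nnd S x * dist v w :=
          mul_lt_mul_of_pos_left (hsq.trans_le h) hd
        rw [dist_comm] at hle
        linarith

/-! ## The stub -/

/-- STUB `develop_charts` (registered on stmt-AtomisticToContinuum-12088, line `registered`; first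
piece of the reshaped `stub_develop`): LOCAL CHARTS WITH EXACT LINKS — at every point `x` of an
everywhere-good separated configuration with reciprocal shells, the shell of `x` is labelled
bijectively by the FCC or the HCP pattern, each shell point within `d(x)/20` of its rotated, scaled
label, and two shell points are shell-neighbours of each other iff their labels touch. -/
theorem develop_charts :
    ∀ δ : ℝ, 0 < δ → ∀ S : Set E3, Sep δ S → (∀ y ∈ S, Good S y) → Recip S → ∀ x ∈ S,
      ∃ P : Finset E3, (P = fccKissingPattern ∨ P = hcpKissingPattern) ∧
        ∃ A : E3 →ₗᵢ[ℝ] E3, ∃ e : E3 → E3, Set.BijOn e (↑P : Set E3) (shell S x) ∧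
          (∀ v ∈ P, dist (e v) (x + nnd S x • A v) ≤ nnd S x / 20) ∧
          (∀ v ∈ P, ∀ w ∈ P, (dist v w = 1 ↔ e w ∈ shell S (e v))) := by
  intro _ _ S _ hG hR x hx
  obtain ⟨A, ⟨e₀, he₀⟩ | ⟨e₀, he₀⟩⟩ := hG x hx
  · obtain ⟨e, hbij, hd, hl⟩ := charts_of_matching hG hR hx
      (fun v hv => norm_eq_one_of_mem_fccKissingPattern hv)
      (Finset.card_pos.1 (by rw [card_fccKissingPattern]; norm_num))
      (fun v hv w hw hvw => dist_eq_one_or_sqrt_two_le_of_mem_fccKissingPattern hv hw hvw) A e₀ he₀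
    exact ⟨fccKissingPattern, Or.inl rfl, A, e, hbij, hd, hl⟩
  · obtain ⟨e, hbij, hd, hl⟩ := charts_of_matching hG hR hx
      (fun v hv => norm_eq_one_of_mem_hcpKissingPattern hv)
      (Finset.card_pos.1 (by rw [card_hcpKissingPattern]; norm_num))
      (fun v hv w hw hvw => dist_eq_one_or_sqrt_two_le_of_mem_hcpKissingPattern hv hw hvw) A e₀ he₀
    exact ⟨hcpKissingPattern, Or.inr rfl, A, e, hbij, hd, hl⟩

end Summit.AtomisticToContinuum.Crystallization.Theorems.HullExactificationCascadeRobustBarlowTemplate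

end
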